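import Literature.MathematicalPhysics.QuantumFieldTheory.HeppBound
import Literature.MathematicalPhysics.QuantumFieldTheory.GraphPeriodProofs
import Literature.MathematicalPhysics.QuantumFieldTheory.HeppSectorIntegral
import Mathlib.Data.List.GetD
import HarnessLib

/-!
# The Hepp bound bounds the period: `P(G) ≤ H(G)` — proof

Topic `MathematicalPhysics/QuantumFieldTheory`. Discharges the named fact
`Literature.MathematicalPhysics.QuantumFieldTheory.Panzer2022_period_le_hepp` of `HeppBound.lean`
(E. Panzer, *Hepp's bound for Feynman graphs and matroids*, AIHPD 10 (2023) = arXiv:1908.09820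
[Panzer2022], eq. (1.6), upper half: `P(G) ≤ H(G)` for connected primitive-divergent `G`) as
`Panzer2022_period_le_hepp_holds`.

## Proof (Panzer 2022, §1 eq. (1.4)–(1.6) and §2.2, in the fixed affine chart `x_N = 1`)

For every ordering `l` of the `N = n + 1` edges (the lists of `orderings univ`, Def. 2.4):
1. (`inv_sq_kirchhoffEval_le_prod_rpow`) on the closed Hepp sector
   `y_{l₀} ≤ y_{l₁} ≤ ⋯ ≤ y_{l_n}` of `y = (x, 1)`, Kruskal's greedy forest `T` along `l`
   (`exists_greedyRows`, Lemma 2.8) gives `Ψ_E(y) ≥ Π_{e ∉ T} y_e` (`prod_compl_le_kirchhoffEval`,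
   i.e. `Ψ ≥ Ψ^trop`), and `#(T ∩ G^l_k) = rk G^l_k`, so
   `1/Ψ_E(y)² ≤ Π_k y_{l_k}^{ω(G^l_{k+1}) - ω(G^l_k) - 1}` with `ω(γ) = |γ| - 2 h₁(γ)`;
2. (`lintegral_sector_eq`) the integral of this sector function over `ℝⁿ` is
   `Π_{k=1}^{n} ω(G^l_k)⁻¹` (`HeppSectorIntegral.lean`: iterated integration below and above the
   position of the edge `N`, using `ω(∅) = ω(G) = 0` and `ω(G^l_k) > 0` from primitive divergence);
3. every `x > 0` lies in the sector of the ordering sorting `(x, 1)` (`Tuple.sort`), hence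
   `∫ dx/Ψ² ≤ Σ_l Π_k ω(G^l_k)⁻¹ = H(G)` (`graphUnitHeppBound`, Def. 2.4 at `a_e = 1`, `D = 4`).
No chart change `x_N = 1 ↔ x_{σ(N)} = 1` is needed: the sector value is the same in every chart.

No definitions are introduced; the per-ordering data (`m` = position of the edge `N`, `c` =
coordinate at a position, `d k = ω(G^l_k)`, the value function `sv` and the chain functionals
`L`, `U` of `HeppSectorIntegral.lean`) are hypotheses `∀ …, F … = <formula>` instantiated by `rfl`.

Deliberately NOT here: the lower half `H(G)·|ST_G|^{-2} ≤ P(G)` of eq. (1.6) (needs the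
matrix-tree count `|ST_G| = Ψ_G(1,…,1)`), the Mellin form (1.5) with general indices and Prop. 2.9,
the sharpness of the sector monomial (`Ψ^trop` is exactly the Kruskal monomial on the sector).

## References

* [Panzer2022] E. Panzer, AIHPD 10 (2023) 31–119, doi:10.4171/aihpd/126, arXiv:1908.09820 —
  §1 eq. (1.4)–(1.6), Def. 2.4, §2.2 (Lemma 2.8, eq. (∗), the sector integral, Prop. 2.9).
* [Brown2009FeynmanPeriods] F. Brown, arXiv:0910.0114, Def. 4, Prop. 21 (`Ψ_G = det M_G`), §3.1.
-/

noncomputable section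

open Matrix Finset MeasureTheory ENNReal Function
open Literature.Combinatorics.Matroid

namespace Literature.MathematicalPhysics.QuantumFieldTheory

/-! ### The monomial bound along an ordering (Kruskal) -/

section Kruskal

variable {N V : ℕ}

/-- **`1/Ψ² ≤` the Hepp-sector monomial of the labelling order.** For a connected edge list on
`N` edges and positive weights `y`, `1/Ψ_E(y)² ≤ Π_k y_k^{D(k+1) - D(k) - 1}` where
`D j = j - 2 h₁(first j edges)` (`= ω` at unit indices, `D = 4`): the greedy forest `T` along the
labelling (`exists_greedyRows`, Kruskal, Panzer 2022 Lemma 2.8) has `Ψ_E(y) ≥ Π_{e∉T} y_e`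
(`prod_compl_le_kirchhoffEval`) and the exponent is `0` on `T`, `-2` off `T`. (The inequality holds
for every order; it is sharp — eq. (∗) of §2.2 — when `y` is sorted.) [cite: Panzer2022, Lemma 2.8 and §2.2 eq. (∗)] -/
theorem inv_sq_kirchhoffEval_le_prod_rpow_sorted (E : Fin N → Fin (V + 1) × Fin (V + 1))
    (hc : IsConnectedEdgeList E) (y : Fin N → ℝ) (hy : ∀ e, 0 < y e) (D : ℕ → ℝ)
    (hD : ∀ j, D j = (j : ℝ) - 2 * (loopNumber E (univ.filter fun i : Fin N => (i : ℕ) < j) : ℝ)) :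
    1 / kirchhoffEval E y ^ 2 ≤ ∏ k : Fin N, y k ^ (D ((k : ℕ) + 1) - D k - 1) := by
  classical
  -- the greedy row basis `T` and its rank counts (as in `heppBound_sorted`)
  set v : Fin N → (Fin V → ℚ) := fun e => reducedIncidence ℚ E e with hv
  obtain ⟨T, hli, hTcount⟩ := exists_greedyRows ℚ v
  have hcount : ∀ m, (T ∩ univ.filter fun k : Fin N => (k : ℕ) < m).card =
      edgeRank E (univ.filter fun k : Fin N => (k : ℕ) < m) := fun m => by
    rw [hTcount, edgeRank_eq_finrank_span]
  have hc' : (reducedIncidence ℚ E).rank = V := hc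
  have hTcard : T.card = V := by
    have := hcount N
    rwa [ltFilter_of_le le_rfl, Finset.inter_univ, edgeRank_univ, hc'] at this
  set t : Fin V ↪o Fin N := T.orderEmbOfFin hTcard with ht
  have htT : univ.image (t : Fin V → Fin N) = T := by
    rw [ht]; exact Finset.image_orderEmbOfFin_univ T hTcard
  have hdetQ : ((reducedIncidence ℚ E).submatrix t id).det ≠ 0 := by
    have hrows : LinearIndependent ℚ ((reducedIncidence ℚ E).submatrix t id).row := by
      have hinj : Function.Injective (fun k : Fin V => (⟨t k, by
          rw [← Finset.mem_coe, ← htT]; simp⟩ : {x // x ∈ T})) :=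
        fun k l hkl => t.injective (congrArg Subtype.val hkl)
      exact hli.linearIndependent.comp _ hinj
    have hunit := Matrix.linearIndependent_rows_iff_isUnit.mp hrows
    exact ((Matrix.isUnit_iff_isUnit_det _).mp hunit).ne_zero
  have hdetZ : ((reducedIncidence ℤ E).submatrix t id).det ≠ 0 := by
    intro h0
    apply hdetQ
    have hmap : (reducedIncidence ℚ E).submatrix t id =
        ((reducedIncidence ℤ E).submatrix t id).map (Int.castRingHom ℚ) := by
      rw [← Matrix.submatrix_map, reducedIncidence_map]
    rw [hmap, ← RingHom.mapMatrix_apply, ← RingHom.map_det, h0, map_zero]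
  obtain ⟨hlow, -⟩ := prod_compl_le_kirchhoffEval E y hy t.strictMono hdetZ
  rw [htT] at hlow
  -- the exponents: `D(k+1) - D k - 1 = 0` on `T`, `-2` off `T`
  have hexp : ∀ k : Fin N, D ((k : ℕ) + 1) - D k - 1 = if k ∈ T then 0 else -2 := by
    intro k
    have hk := k.isLt
    have hr : edgeRank E (univ.filter fun i : Fin N => (i : ℕ) < (k : ℕ) + 1) =
        edgeRank E (univ.filter fun i : Fin N => (i : ℕ) < k) + (if k ∈ T then 1 else 0) := by
      rw [← hcount, ← hcount, ltFilter_succ hk]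
      by_cases hkT : k ∈ T
      · rw [if_pos hkT, Finset.inter_insert_of_mem hkT, Finset.card_insert_of_notMem]
        exact fun h => not_mem_ltFilter_self hk (Finset.mem_inter.1 h).2
      · rw [if_neg hkT, Finset.inter_insert_of_notMem hkT, add_zero]
    have hle1 := edgeRank_le_card E (univ.filter fun i : Fin N => (i : ℕ) < (k : ℕ) + 1)
    have hle0 := edgeRank_le_card E (univ.filter fun i : Fin N => (i : ℕ) < k)
    rw [card_ltFilter (by omega)] at hle1
    rw [card_ltFilter (by omega)] at hle0
    rw [hD, hD, loopNumber, loopNumber, card_ltFilter (by omega), card_ltFilter (by omega), hr,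
      Nat.cast_sub (by split_ifs <;> omega), Nat.cast_sub hle0]
    push_cast
    split_ifs <;> ring
  -- the bound
  have hP : 0 < ∏ e ∈ Tᶜ, y e := prod_pos fun e _ => hy e
  have hΨ : 0 < kirchhoffEval E y := hP.trans_le hlow
  calc 1 / kirchhoffEval E y ^ 2 ≤ 1 / (∏ e ∈ Tᶜ, y e) ^ 2 :=
        one_div_le_one_div_of_le (pow_pos hP 2) (pow_le_pow_left₀ hP.le hlow 2)
    _ = ∏ e ∈ Tᶜ, y e ^ (-2 : ℝ) := by
        rw [Real.finsetProd_rpow _ _ (fun e _ => (hy e).le), Real.rpow_neg hP.le, Real.rpow_two,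
          one_div]
    _ = ∏ k : Fin N, y k ^ (D ((k : ℕ) + 1) - D k - 1) := by
        have hT1 : ∏ k ∈ T, y k ^ (D ((k : ℕ) + 1) - D k - 1) = 1 :=
          Finset.prod_eq_one fun k hk => by rw [hexp k, if_pos hk, Real.rpow_zero]
        have hTc : ∏ k ∈ Tᶜ, y k ^ (D ((k : ℕ) + 1) - D k - 1) = ∏ k ∈ Tᶜ, y k ^ (-2 : ℝ) :=
          Finset.prod_congr rfl fun k hk => by rw [hexp k, if_neg (Finset.mem_compl.1 hk)]
        rw [← Finset.prod_mul_prod_compl T (fun k : Fin N => y k ^ (D ((k : ℕ) + 1) - D k - 1)),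
          hT1, hTc, one_mul]

/-- **`1/Ψ² ≤` the Hepp-sector monomial of an arbitrary ordering.** For positive weights `y` and a
permutation `σ` of the edges, `1/Ψ_E(y)² ≤ Π_k y_{σ k}^{D(k+1) - D(k) - 1}` with
`D j = j - 2 h₁(σ(first j positions))` — the previous lemma for the relabelled edge list
`E ∘ σ` (`kirchhoffEval_comp_perm`, `loopNumber_comp_perm`). [cite: Panzer2022, Lemma 2.8 and §2.2 eq. (∗)] -/
theorem inv_sq_kirchhoffEval_le_prod_rpow (E : Fin N → Fin (V + 1) × Fin (V + 1))
    (hc : IsConnectedEdgeList E) (y : Fin N → ℝ) (hy : ∀ e, 0 < y e) (σ : Equiv.Perm (Fin N))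
    (D : ℕ → ℝ) (hD : ∀ j, D j = (j : ℝ) - 2 * (loopNumber E
      ((univ.filter fun i : Fin N => (i : ℕ) < j).map σ.toEmbedding) : ℝ)) :
    1 / kirchhoffEval E y ^ 2 ≤ ∏ k : Fin N, y (σ k) ^ (D ((k : ℕ) + 1) - D k - 1) := by
  have h := inv_sq_kirchhoffEval_le_prod_rpow_sorted (E ∘ σ) (isConnectedEdgeList_comp_perm E σ hc)
    (y ∘ σ) (fun e => hy _) D (fun j => by rw [hD, loopNumber_comp_perm])
  rwa [kirchhoffEval_comp_perm] at h

end Kruskal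

/-! ### Orderings as lists -/

section Orderings

variable {n : ℕ}

/-- An ordering of `Fin (n+1)` (a list of `orderings univ`) has no duplicates, length `n + 1`, and
contains every element. [folklore] -/
theorem nodup_length_mem_of_coe_eq_univ {l : List (Fin (n + 1))}
    (hl : (l : Multiset (Fin (n + 1))) = (univ : Finset (Fin (n + 1))).val) :
    l.Nodup ∧ l.length = n + 1 ∧ ∀ e, e ∈ l := by
  refine ⟨?_, ?_, fun e => ?_⟩
  · have h := (univ : Finset (Fin (n + 1))).nodup
    rw [← hl] at h
    exact Multiset.coe_nodup.1 h
  · have h := congrArg Multiset.card hl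
    simpa using h
  · rw [← Multiset.mem_coe, hl]
    exact Finset.mem_univ_val e

/-- The first `k ≤ n + 1` entries of an ordering form a `k`-element set. [folklore] -/
theorem card_toFinset_take {l : List (Fin (n + 1))}
    (hl : (l : Multiset (Fin (n + 1))) = (univ : Finset (Fin (n + 1))).val) {k : ℕ}
    (hk : k ≤ n + 1) : (l.take k).toFinset.card = k := by
  obtain ⟨hnd, hlen, -⟩ := nodup_length_mem_of_coe_eq_univ hl
  rw [List.toFinset_card_of_nodup (hnd.sublist (List.take_sublist k l)), List.length_take, hlen,
    min_eq_left hk]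

/-- All `n + 1` entries of an ordering form the whole edge set. [folklore] -/
theorem toFinset_take_length {l : List (Fin (n + 1))}
    (hl : (l : Multiset (Fin (n + 1))) = (univ : Finset (Fin (n + 1))).val) :
    (l.take (n + 1)).toFinset = univ := by
  obtain ⟨-, hlen, hmem⟩ := nodup_length_mem_of_coe_eq_univ hl
  rw [List.take_of_length_le hlen.le]
  exact Finset.eq_univ_of_forall fun e => List.mem_toFinset.2 (hmem e)

/-- The list of a permutation is an ordering. [folklore] -/
theorem coe_ofFn_perm_eq_univ (σ : Equiv.Perm (Fin (n + 1))) :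
    ((List.ofFn (⇑σ) : List (Fin (n + 1))) : Multiset (Fin (n + 1))) =
      (univ : Finset (Fin (n + 1))).val := by
  have hnd : (List.ofFn (⇑σ)).Nodup := List.nodup_ofFn.2 σ.injective
  have huniv : (List.ofFn (⇑σ)).toFinset = univ := Finset.eq_univ_of_forall fun e =>
    List.mem_toFinset.2 (List.mem_ofFn.2 ⟨σ.symm e, σ.apply_symm_apply e⟩)
  rw [← huniv, List.toFinset_val, hnd.dedup]

/-- The first `j` entries of the list of a permutation are the images of the first `j`
positions. [folklore] -/
theorem toFinset_take_ofFn (σ : Equiv.Perm (Fin (n + 1))) (j : ℕ) :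
    ((List.ofFn (⇑σ)).take j).toFinset =
      (univ.filter fun i : Fin (n + 1) => (i : ℕ) < j).map σ.toEmbedding := by
  ext e
  rw [List.mem_toFinset, Finset.mem_map, List.mem_iff_getElem]
  constructor
  · rintro ⟨i, hi, rfl⟩
    rw [List.length_take, List.length_ofFn] at hi
    refine ⟨⟨i, by omega⟩, by simp only [Finset.mem_filter, Finset.mem_univ, true_and]; omega, ?_⟩
    rw [List.getElem_take, List.getElem_ofFn]
    rfl
  · rintro ⟨k, hk, rfl⟩
    simp only [Finset.mem_filter, Finset.mem_univ, true_and] at hk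
    refine ⟨k, by rw [List.length_take, List.length_ofFn]; omega, ?_⟩
    rw [List.getElem_take, List.getElem_ofFn]
    rfl

end Orderings

/-! ### One ordering: the sector function, its integral and the pointwise bound -/

section Sector

variable {n V : ℕ} (E : Fin (n + 1) → Fin (V + 1) × Fin (V + 1)) (l : List (Fin (n + 1)))
  {m : ℕ} {c : ℕ → Fin n} {d : ℕ → ℝ} {sv : (Fin n → ℝ) → ℕ → ℝ}
  {L U : ℕ → (Fin n → ℝ) → ℝ≥0∞}

/-- Positions of an ordering: the edge at position `k` is `l.getD k (Fin.last n)`; the special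
position `m` (of the edge `Fin.last n`, whose weight is `1` in the affine chart) is `< n + 1`,
carries `Fin.last n`, and no other position `≤ n` does. [folklore] -/
theorem positions_of_ordering
    (hl : (l : Multiset (Fin (n + 1))) = (univ : Finset (Fin (n + 1))).val)
    (hm : m = l.idxOf (Fin.last n)) :
    m < n + 1 ∧ l.getD m (Fin.last n) = Fin.last n ∧
      (∀ k, k < n + 1 → k ≠ m → l.getD k (Fin.last n) ≠ Fin.last n) ∧
      ∀ k k', k < n + 1 → k' < n + 1 → l.getD k (Fin.last n) = l.getD k' (Fin.last n) → k = k' := by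
  obtain ⟨hnd, hlen, hmem⟩ := nodup_length_mem_of_coe_eq_univ hl
  have hmlt : m < l.length := by rw [hm]; exact List.idxOf_lt_length_iff.2 (hmem _)
  have hget : ∀ k (hk : k < n + 1), l.getD k (Fin.last n) = l[k]'(by omega) := fun k hk =>
    List.getD_eq_getElem _ _ (by omega)
  refine ⟨by omega, ?_, fun k hk hkm h => hkm ?_, fun k k' hk hk' h => ?_⟩
  · rw [hget m (by omega)]
    simp only [hm]
    exact List.getElem_idxOf (by rwa [← hm])
  · rw [hget k hk] at h
    have h2 : l[k]'(by omega) = l[m]'hmlt := by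
      rw [h]; symm; simp only [hm]; exact List.getElem_idxOf (by rwa [← hm])
    exact (hnd.getElem_inj_iff).1 h2
  · rw [hget k hk, hget k' hk'] at h
    exact (hnd.getElem_inj_iff).1 h

/-- **Power counting**: for a primitive-divergent edge list and `1 ≤ k ≤ n`, the first `k` edges of
any ordering have `ω(G^l_k) = k - 2 h₁(G^l_k) > 0` (Brown 2009, Def. 4; Panzer 2022, Prop. 2.9:
unit indices lie in the convergence cone `Λ`). [cite: Panzer2022, Prop. 2.9 (the cone Λ)] -/
theorem sdc_take_pos (hp : IsPrimitiveDivergent E)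
    (hl : (l : Multiset (Fin (n + 1))) = (univ : Finset (Fin (n + 1))).val) {k : ℕ} (hk1 : 1 ≤ k)
    (hkn : k ≤ n) : 0 < (k : ℝ) - 2 * (loopNumber E (l.take k).toFinset : ℝ) := by
  have hcard := card_toFinset_take hl (show k ≤ n + 1 by omega)
  have hne : (l.take k).toFinset.Nonempty := Finset.card_pos.1 (by omega)
  have hnu : (l.take k).toFinset ≠ univ := fun h => by
    have := congrArg Finset.card h
    rw [hcard, Finset.card_univ, Fintype.card_fin] at this
    omega
  have h2 := hp.2 _ hne hnu
  rw [hcard] at h2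
  have h3 : (2 * loopNumber E (l.take k).toFinset : ℝ) < k := by exact_mod_cast h2
  linarith

/-- **The integral of the sector function of one ordering** is `Π_{k=1}^{n} ω(G^l_k)⁻¹`
(Panzer 2022, §2.2; `lintegral_lower_mul_upper` with `d k = ω(G^l_k) = k - 2 h₁(G^l_k)`:
`d 0 = 0`, `d (n+1) = ω(G) = 0` and `d k > 0` for `1 ≤ k ≤ n` by primitive divergence).
[cite: Panzer2022, §2.2 (sector integral) with Def. 2.4] -/
theorem lintegral_sector_eq (hp : IsPrimitiveDivergent E) (hn : 0 < n)
    (hl : (l : Multiset (Fin (n + 1))) = (univ : Finset (Fin (n + 1))).val)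
    (hm : m = l.idxOf (Fin.last n))
    (hc : ∀ k, (c k : ℕ) = min (l.getD k (Fin.last n) : ℕ) (n - 1))
    (hd : ∀ k, d k = (k : ℝ) - 2 * (loopNumber E (l.take k).toFinset : ℝ))
    (hsv : ∀ x k, sv x k = if k = m then 1 else x (c k))
    (hL : ∀ i x, L i x = {x | 0 < sv x i ∧ ∀ k ∈ Ico i m,
      sv x k ≤ sv x (k + 1) ∧ 0 ≤ sv x k}.indicator 1 x *
        ∏ k ∈ Ico i m, ENNReal.ofReal (sv x k ^ (d (k + 1) - d k - 1)))
    (hU : ∀ j x, U j x = {x | 1 ≤ sv x j ∧ ∀ k ∈ Ico m j,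
      sv x k ≤ sv x (k + 1) ∧ 1 ≤ sv x k}.indicator 1 x *
        ∏ k ∈ Ico (m + 1) (j + 1), ENNReal.ofReal (sv x k ^ (d (k + 1) - d k - 1))) :
    ∫⁻ x, L 0 x * U n x = ENNReal.ofReal (∏ k ∈ Ico 1 (n + 1), (d k)⁻¹) := by
  obtain ⟨hmn, hvm, hvne, hvinj⟩ := positions_of_ordering l hl hm
  obtain ⟨hnd, hlen, hmem⟩ := nodup_length_mem_of_coe_eq_univ hl
  -- the coordinate at a position `k ≠ m` is the edge there (which is `< n`)
  have hcv : ∀ k, k < n + 1 → k ≠ m → (c k : ℕ) = (l.getD k (Fin.last n) : ℕ) := by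
    intro k hk hkm
    have hlt : (l.getD k (Fin.last n) : ℕ) < n := by
      have h1 := (l.getD k (Fin.last n)).isLt
      have h2 : (l.getD k (Fin.last n) : ℕ) ≠ n := fun h =>
        hvne k hk hkm (Fin.ext (by rw [h, Fin.val_last]))
      omega
    rw [hc k]
    omega
  refine lintegral_lower_mul_upper hsv hL hU (by omega) ?_ ?_ ?_ ?_ ?_
  · -- injectivity of `c` on the positions `≠ m`
    intro k k' hk hk' hkm hk'm hce
    have h := congrArg Fin.val hce
    rw [hcv k (by omega) hkm, hcv k' (by omega) hk'm] at h
    exact hvinj k k' (by omega) (by omega) (Fin.ext h)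
  · -- surjectivity onto the coordinates
    intro e
    have hk := List.idxOf_lt_length_iff.2 (hmem (Fin.castSucc e))
    refine ⟨l.idxOf (Fin.castSucc e), by omega, fun h => ?_, ?_⟩
    · have h1 : l.getD (l.idxOf (Fin.castSucc e)) (Fin.last n) = Fin.castSucc e := by
        rw [List.getD_eq_getElem _ _ hk]; exact List.getElem_idxOf hk
      rw [h, hvm] at h1
      exact (Fin.castSucc_lt_last e).ne h1.symm
    · apply Fin.ext
      rw [hcv _ (by omega) (fun h => ?_), List.getD_eq_getElem _ _ hk, List.getElem_idxOf hk,
        Fin.val_castSucc]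
      have h1 : l.getD (l.idxOf (Fin.castSucc e)) (Fin.last n) = Fin.castSucc e := by
        rw [List.getD_eq_getElem _ _ hk]; exact List.getElem_idxOf hk
      rw [h, hvm] at h1
      exact (Fin.castSucc_lt_last e).ne h1.symm
  · -- `d 0 = 0`
    rw [hd]
    simp [loopNumber]
  · -- `d (n+1) = ω(G) = 0`
    rw [hd, toFinset_take_length hl]
    have h1 := hp.1
    push_cast
    have : ((n + 1 : ℕ) : ℝ) = 2 * (loopNumber E univ : ℝ) := by exact_mod_cast h1
    push_cast at this
    linarith
  · -- `d k > 0` for `1 ≤ k ≤ n`: primitive divergence of the proper subgraph `G^l_k`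
    intro k hk1 hkn
    rw [hd]
    exact sdc_take_pos E l hp hl hk1 hkn

/-- **The pointwise bound on the sector of the sorting ordering.** For `x` in the open orthant,
`y = (x, 1)` and the ordering `l = [σ 0, …, σ n]` of the permutation `σ` sorting `y`
(`Tuple.sort`), the period integrand `1/Ψ_E(x,1)²` is at most the sector function `L 0 x · U n x`
of `l` (all its indicator constraints hold by monotonicity of `y ∘ σ`, and the monomial bound is
`inv_sq_kirchhoffEval_le_prod_rpow`). [cite: Panzer2022, §1 eq. (1.6) and §2.2 eq. (∗)] -/
theorem ofReal_graphPeriodIntegrand_le_sector (hcE : IsConnectedEdgeList E)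
    (hn : 0 < n) (x : Fin n → ℝ) (hx : x ∈ openOrthant n)
    (hlσ : l = List.ofFn ⇑(Tuple.sort (Fin.snoc x (1 : ℝ) : Fin (n + 1) → ℝ)))
    (hm : m = l.idxOf (Fin.last n))
    (hc : ∀ k, (c k : ℕ) = min (l.getD k (Fin.last n) : ℕ) (n - 1))
    (hd : ∀ k, d k = (k : ℝ) - 2 * (loopNumber E (l.take k).toFinset : ℝ))
    (hsv : ∀ x k, sv x k = if k = m then 1 else x (c k))
    (hL : ∀ i x, L i x = {x | 0 < sv x i ∧ ∀ k ∈ Ico i m,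
      sv x k ≤ sv x (k + 1) ∧ 0 ≤ sv x k}.indicator 1 x *
        ∏ k ∈ Ico i m, ENNReal.ofReal (sv x k ^ (d (k + 1) - d k - 1)))
    (hU : ∀ j x, U j x = {x | 1 ≤ sv x j ∧ ∀ k ∈ Ico m j,
      sv x k ≤ sv x (k + 1) ∧ 1 ≤ sv x k}.indicator 1 x *
        ∏ k ∈ Ico (m + 1) (j + 1), ENNReal.ofReal (sv x k ^ (d (k + 1) - d k - 1))) :
    ENNReal.ofReal (graphPeriodIntegrand E x) ≤ L 0 x * U n x := by
  set y : Fin (n + 1) → ℝ := Fin.snoc x 1 with hydef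
  set σ : Equiv.Perm (Fin (n + 1)) := Tuple.sort y with hσ
  have hmono : Monotone (y ∘ σ) := Tuple.monotone_sort y
  have hy : ∀ e, 0 < y e := snoc_pos hx
  have hl : (l : Multiset (Fin (n + 1))) = (univ : Finset (Fin (n + 1))).val := by
    rw [hlσ]; exact coe_ofFn_perm_eq_univ σ
  obtain ⟨hmn, hvm, hvne, hvinj⟩ := positions_of_ordering l hl hm
  -- position `k` carries the edge `σ k`, and its value is `y (σ k)`
  have hv : ∀ k (hk : k < n + 1), l.getD k (Fin.last n) = σ ⟨k, hk⟩ := by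
    intro k hk
    rw [hlσ, List.getD_eq_getElem _ _ (by rw [List.length_ofFn]; exact hk), List.getElem_ofFn]
  have hval : ∀ k (hk : k < n + 1), sv x k = y (σ ⟨k, hk⟩) := by
    intro k hk
    rw [hsv]
    split_ifs with hkm
    · subst hkm
      rw [← hv, hvm, hydef, Fin.snoc_last]
    · have hlt : (l.getD k (Fin.last n) : ℕ) < n := by
        have h1 := (l.getD k (Fin.last n)).isLt
        have h2 : (l.getD k (Fin.last n) : ℕ) ≠ n := fun h =>
          hvne k hk hkm (Fin.ext (by rw [h, Fin.val_last]))
        omega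
      have hck : Fin.castSucc (c k) = σ ⟨k, hk⟩ := by
        rw [← hv k hk]
        apply Fin.ext
        rw [Fin.val_castSucc, hc k]
        omega
      rw [← hck, hydef, Fin.snoc_castSucc]
  have hvalmono : ∀ k k', k ≤ k' → k' < n + 1 → sv x k ≤ sv x k' := by
    intro k k' hkk' hk'
    rw [hval k (by omega), hval k' hk']
    exact hmono (Fin.mk_le_mk.2 hkk')
  have hvalpos : ∀ k, k < n + 1 → 0 < sv x k := fun k hk => by rw [hval k hk]; exact hy _
  have hval1 : ∀ k, m ≤ k → k < n + 1 → 1 ≤ sv x k := fun k hmk hk => by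
    have := hvalmono m k hmk hk
    rwa [sv_self hsv] at this
  -- the indicator constraints hold
  have hmemL : x ∈ {x : Fin n → ℝ | 0 < sv x 0 ∧ ∀ k ∈ Ico 0 m,
      sv x k ≤ sv x (k + 1) ∧ 0 ≤ sv x k} :=
    ⟨hvalpos 0 (by omega), fun k hk => by
      rw [Finset.mem_Ico] at hk
      exact ⟨hvalmono k (k + 1) (by omega) (by omega), (hvalpos k (by omega)).le⟩⟩
  have hmemU : x ∈ {x : Fin n → ℝ | 1 ≤ sv x n ∧ ∀ k ∈ Ico m n,
      sv x k ≤ sv x (k + 1) ∧ 1 ≤ sv x k} :=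
    ⟨hval1 n (by omega) (by omega), fun k hk => by
      rw [Finset.mem_Ico] at hk
      exact ⟨hvalmono k (k + 1) (by omega) (by omega), hval1 k hk.1 (by omega)⟩⟩
  rw [hL, hU, Set.indicator_of_mem hmemL, Set.indicator_of_mem hmemU, Pi.one_apply, one_mul,
    one_mul]
  -- the monomial bound, transported to positions
  have hbound := inv_sq_kirchhoffEval_le_prod_rpow E hcE y hy σ d
    (fun j => by rw [hd, hlσ, toFinset_take_ofFn])
  have hprod : (∏ k : Fin (n + 1), y (σ k) ^ (d ((k : ℕ) + 1) - d k - 1)) =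
      ∏ k ∈ range (n + 1), sv x k ^ (d (k + 1) - d k - 1) := by
    rw [← Fin.prod_univ_eq_prod_range (fun k => sv x k ^ (d (k + 1) - d k - 1)) (n + 1)]
    exact Finset.prod_congr rfl fun k _ => by rw [hval k k.isLt]
  have hsplit : (∏ k ∈ range (n + 1), ENNReal.ofReal (sv x k ^ (d (k + 1) - d k - 1))) =
      (∏ k ∈ Ico 0 m, ENNReal.ofReal (sv x k ^ (d (k + 1) - d k - 1))) *
        ∏ k ∈ Ico (m + 1) (n + 1), ENNReal.ofReal (sv x k ^ (d (k + 1) - d k - 1)) := by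
    rw [Finset.range_eq_Ico, ← Finset.prod_Ico_consecutive _ (Nat.zero_le m) (by omega : m ≤ n + 1),
      Finset.prod_eq_prod_Ico_succ_bot hmn, sv_self hsv, Real.one_rpow, ENNReal.ofReal_one, one_mul]
  calc ENNReal.ofReal (graphPeriodIntegrand E x)
      ≤ ENNReal.ofReal (∏ k ∈ range (n + 1), sv x k ^ (d (k + 1) - d k - 1)) := by
        refine ENNReal.ofReal_le_ofReal ?_
        rw [← hprod]
        exact hbound
    _ = ∏ k ∈ range (n + 1), ENNReal.ofReal (sv x k ^ (d (k + 1) - d k - 1)) :=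
        ENNReal.ofReal_prod_of_nonneg fun k hk =>
          Real.rpow_nonneg (hvalpos k (Finset.mem_range.1 hk)).le _
    _ = _ := hsplit

end Sector

/-! ### The Hepp bound as a real number, and the assembly -/

section Assembly

variable {n V : ℕ}

/-- The rational Hepp bound `H(G) = Σ_σ Π_{k=1}^{N-1} ω(G^σ_k)⁻¹` (Def. 2.4, unit indices, `D = 4`)
cast to `ℝ`, with `ω(G^σ_k) = k - 2 h₁(G^σ_k)`. [cite: Panzer2022, Def. 2.4 and eq. (1.5)] -/
theorem cast_graphUnitHeppBound (E : Fin (n + 1) → Fin (V + 1) × Fin (V + 1)) :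
    ((graphUnitHeppBound E : ℚ) : ℝ) = ∑ l ∈ orderings (univ : Finset (Fin (n + 1))),
      ∏ k ∈ Ico 1 (n + 1), ((k : ℝ) - 2 * (loopNumber E (l.take k).toFinset : ℝ))⁻¹ := by
  classical
  have h : graphUnitHeppBound E =
      heppSumOfCorank (loopNumber E) (univ : Finset (Fin (n + 1))) (4 : ℚ) fun _ => 1 := rfl
  rw [h, heppSumOfCorank_eq, Finset.card_univ, Fintype.card_fin]
  push_cast
  refine Finset.sum_congr rfl fun l hl => Finset.prod_congr rfl fun k hk => ?_
  rw [mem_orderings_iff] at hl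
  rw [sdcOfCorank_apply, Finset.sum_const, nsmul_eq_mul, mul_one,
    card_toFinset_take hl (by have := (Finset.mem_Ico.1 hk).2; omega)]
  push_cast
  ring

/-- **Discharge of `Panzer2022_period_le_hepp`** (Panzer 2022, eq. (1.6), upper half): for a
connected primitive-divergent edge list, `P(G) ≤ H(G)` — the period `∫_{x>0} dx/Ψ_E(x,1)²` is at
most the unit-index Hepp bound of Def. 2.4. Proof: `Ψ ≥ Ψ^trop` sector by sector
(`ofReal_graphPeriodIntegrand_le_sector`), the sector integrals `Π_k ω(G^σ_k)⁻¹`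
(`lintegral_sector_eq`), summed over all orderings (`cast_graphUnitHeppBound`). [cite: Panzer2022, eq. (1.6)] -/
theorem Panzer2022_period_le_hepp_holds : Panzer2022_period_le_hepp := by
  intro n V E hcE hp
  classical
  have hn : 0 < n := by
    rcases Nat.eq_zero_or_pos n with h | h
    · subst h
      have h1 := hp.1
      omega
    · exact h
  -- the per-ordering data and the sector function `G l` (no definitions: local abbreviations)
  set cf : List (Fin (n + 1)) → ℕ → Fin n := fun l k =>
    ⟨min (l.getD k (Fin.last n) : ℕ) (n - 1), by omega⟩ with hcf
  set df : List (Fin (n + 1)) → ℕ → ℝ := fun l k =>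
    (k : ℝ) - 2 * (loopNumber E (l.take k).toFinset : ℝ) with hdf
  set svf : List (Fin (n + 1)) → (Fin n → ℝ) → ℕ → ℝ := fun l x k =>
    if k = l.idxOf (Fin.last n) then 1 else x (cf l k) with hsvf
  set Lf : List (Fin (n + 1)) → ℕ → (Fin n → ℝ) → ℝ≥0∞ := fun l i x =>
    {x | 0 < svf l x i ∧ ∀ k ∈ Ico i (l.idxOf (Fin.last n)),
      svf l x k ≤ svf l x (k + 1) ∧ 0 ≤ svf l x k}.indicator 1 x *
        ∏ k ∈ Ico i (l.idxOf (Fin.last n)),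
          ENNReal.ofReal (svf l x k ^ (df l (k + 1) - df l k - 1)) with hLf
  set Uf : List (Fin (n + 1)) → ℕ → (Fin n → ℝ) → ℝ≥0∞ := fun l j x =>
    {x | 1 ≤ svf l x j ∧ ∀ k ∈ Ico (l.idxOf (Fin.last n)) j,
      svf l x k ≤ svf l x (k + 1) ∧ 1 ≤ svf l x k}.indicator 1 x *
        ∏ k ∈ Ico (l.idxOf (Fin.last n) + 1) (j + 1),
          ENNReal.ofReal (svf l x k ^ (df l (k + 1) - df l k - 1)) with hUf
  set G : List (Fin (n + 1)) → (Fin n → ℝ) → ℝ≥0∞ := fun l x => Lf l 0 x * Uf l n x with hG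
  -- (2) the integral of each sector function
  have hint : ∀ l ∈ orderings (univ : Finset (Fin (n + 1))),
      ∫⁻ x, G l x = ENNReal.ofReal (∏ k ∈ Ico 1 (n + 1), (df l k)⁻¹) := fun l hl =>
    lintegral_sector_eq E l hp hn (mem_orderings_iff.1 hl) (m := l.idxOf (Fin.last n))
      (c := cf l) (d := df l) (sv := svf l) (L := Lf l) (U := Uf l) rfl (fun _ => rfl)
      (fun _ => rfl) (fun _ _ => rfl) (fun _ _ => rfl) (fun _ _ => rfl)
  have hmeasG : ∀ l, Measurable (G l) := fun l =>
    (measurable_lower (m := l.idxOf (Fin.last n)) (c := cf l) (d := df l) (sv := svf l)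
        (L := Lf l) (fun _ _ => rfl) (fun _ _ => rfl) 0).mul
      (measurable_upper (m := l.idxOf (Fin.last n)) (c := cf l) (d := df l) (sv := svf l)
        (U := Uf l) (fun _ _ => rfl) (fun _ _ => rfl) n)
  -- (1) + (3) the pointwise bound on the sector of the sorting ordering
  have hpt : ∀ x ∈ openOrthant n, ENNReal.ofReal (graphPeriodIntegrand E x) ≤
      ∑ l ∈ orderings (univ : Finset (Fin (n + 1))), G l x := by
    intro x hx
    set l₀ : List (Fin (n + 1)) := List.ofFn ⇑(Tuple.sort (Fin.snoc x (1 : ℝ) : Fin (n + 1) → ℝ))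
      with hl₀
    have hmem : l₀ ∈ orderings (univ : Finset (Fin (n + 1))) :=
      mem_orderings_iff.2 (coe_ofFn_perm_eq_univ _)
    have hle : ENNReal.ofReal (graphPeriodIntegrand E x) ≤ G l₀ x :=
      ofReal_graphPeriodIntegrand_le_sector E l₀ hcE hn x hx hl₀ (m := l₀.idxOf (Fin.last n))
        (c := cf l₀) (d := df l₀) (sv := svf l₀) (L := Lf l₀) (U := Uf l₀) rfl (fun _ => rfl)
        (fun _ => rfl) (fun _ _ => rfl) (fun _ _ => rfl) (fun _ _ => rfl)
    exact hle.trans (Finset.single_le_sum (f := fun l => G l x) (fun _ _ => zero_le) hmem)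
  -- the Hepp bound is the sum of the sector values, and it is non-negative
  have hH : ((graphUnitHeppBound E : ℚ) : ℝ) = ∑ l ∈ orderings (univ : Finset (Fin (n + 1))),
      ∏ k ∈ Ico 1 (n + 1), (df l k)⁻¹ := cast_graphUnitHeppBound E
  have hdpos : ∀ l ∈ orderings (univ : Finset (Fin (n + 1))), ∀ k ∈ Ico 1 (n + 1),
      0 < df l k := fun l hl k hk =>
    sdc_take_pos E l hp (mem_orderings_iff.1 hl) (Finset.mem_Ico.1 hk).1
      (by have := (Finset.mem_Ico.1 hk).2; omega)
  have hHnn : 0 ≤ ∑ l ∈ orderings (univ : Finset (Fin (n + 1))),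
      ∏ k ∈ Ico 1 (n + 1), (df l k)⁻¹ :=
    Finset.sum_nonneg fun l hl => Finset.prod_nonneg fun k hk =>
      inv_nonneg.2 (hdpos l hl k hk).le
  -- measurability of the orthant
  have hset : openOrthant n = Set.univ.pi fun _ : Fin n => Set.Ioi (0 : ℝ) := by
    ext x
    simp [openOrthant]
  have hmeasO : MeasurableSet (openOrthant n) := by
    rw [hset]
    exact MeasurableSet.univ_pi fun _ => measurableSet_Ioi
  -- the bound on the lower Lebesgue integral
  have key : ∫⁻ x in openOrthant n, ENNReal.ofReal (graphPeriodIntegrand E x) ≤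
      ENNReal.ofReal (∑ l ∈ orderings (univ : Finset (Fin (n + 1))),
        ∏ k ∈ Ico 1 (n + 1), (df l k)⁻¹) :=
    calc ∫⁻ x in openOrthant n, ENNReal.ofReal (graphPeriodIntegrand E x)
        ≤ ∫⁻ x in openOrthant n, ∑ l ∈ orderings (univ : Finset (Fin (n + 1))), G l x :=
          setLIntegral_mono' hmeasO hpt
      _ ≤ ∫⁻ x, ∑ l ∈ orderings (univ : Finset (Fin (n + 1))), G l x :=
          setLIntegral_le_lintegral _ _
      _ = ∑ l ∈ orderings (univ : Finset (Fin (n + 1))), ∫⁻ x, G l x :=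
          lintegral_finsetSum _ fun l _ => hmeasG l
      _ = ∑ l ∈ orderings (univ : Finset (Fin (n + 1))),
            ENNReal.ofReal (∏ k ∈ Ico 1 (n + 1), (df l k)⁻¹) :=
          Finset.sum_congr rfl hint
      _ = ENNReal.ofReal (∑ l ∈ orderings (univ : Finset (Fin (n + 1))),
            ∏ k ∈ Ico 1 (n + 1), (df l k)⁻¹) :=
          (ENNReal.ofReal_sum_of_nonneg fun l hl => Finset.prod_nonneg fun k hk =>
            inv_nonneg.2 (hdpos l hl k hk).le).symm
  -- from the lower Lebesgue integral to the Bochner integral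
  calc graphPeriod E = ∫ x in openOrthant n, graphPeriodIntegrand E x := rfl
    _ = (∫⁻ x in openOrthant n, ENNReal.ofReal (graphPeriodIntegrand E x)).toReal :=
        integral_eq_lintegral_of_nonneg_ae
          (ae_of_all _ fun x => by unfold graphPeriodIntegrand; positivity)
          (measurable_graphPeriodIntegrand E).aestronglyMeasurable
    _ ≤ ∑ l ∈ orderings (univ : Finset (Fin (n + 1))), ∏ k ∈ Ico 1 (n + 1), (df l k)⁻¹ :=
        ENNReal.toReal_le_of_le_ofReal hHnn key
    _ = (graphUnitHeppBound E : ℝ) := hH.symm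

end Assembly

end Literature.MathematicalPhysics.QuantumFieldTheory
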